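import Summits.ResolutionOfSingularities.ResolutionOfSingularities.Theorems.MarkedTransferCampaignW24ReducedBridgeQStep
import Summits.ResolutionOfSingularities.ResolutionOfSingularities.Theorems.MarkedTransferCampaignW24ReducedBridgeMixedRun
import HarnessLib

/-!
# The LEVEL-`q` bridge, part 4: runs, box-confinement, and ⟨`Rescue.FiniteSupportStaysInBox_ours 2`⟩ ON THE WHOLE SLICE `n = 1`
# (every level `e`, every polynomial carrier; one variable, characteristic 2) (HIRONAKA-L · cell `res-hironaka` · slot W2.4 «bottom-member
# re-run»; supersedes the `e = 1` slice theorem `carrierStaysInBox_coe_fin_one` of `…ReducedBridgeMixedRun.lean`)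

**HONEST FRAMING.** OURS throughout: kernel theorems connecting OURS objects of the cell (res-L1-k24's `CampaignW24.ReducedRun`, res-type-059's
`CampaignW24.StaysInBox/IsBottomRun/stepAt`, res-L1-type-o6's `ReducedRun.reduced_exhaustion_of_two_le_order`, res-D-pv-031's
`Rescue.RD2Prime.isLowerClass_stepAt_of_isLowerClass`, res-D-pv-020's `CampaignW24.ReducedBridge`). Nothing below is a statement of H. Hironaka's
manuscript [Hironaka2017] (lit key `paper:url-3343fd9e678b`), nothing asserts that any statement of it holds, nothing is a claim about resolution
of singularities in characteristic `p`; the manuscript stays «under review» (D-0012/D-0089). AI work, weaker than expert review. res-D-pv-020 (W2.4).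

## What is proved (`K` of characteristic 2; `0 < e ≤ ℓ`; `q = 2^e`; `F = Φ_{q,r₀} G + R`, `r₀ < q`, passenger residues in `good ⊆ PairLT · r₀`)
* §1 `isLowerClass_of_resIn` (passengers are of lower class); §2 `run_of_level(_digitOne)` (the state is `Φ_{q,r₀}(canonRun 2^{ℓ−e} … i) + R_i`
  up to the reduced death index) and `staysInBox_of_level_of_reduced_exhaustion(_digitOne)`; §3 `StaysInBox 2 e ℓ X₀` at every large depth.
* §4 **`carrierStaysInBox_coe_fin_one_level (e) (P : MvPolynomial (Fin 1) K) : Rescue.CarrierStaysInBox 2 e ↑P`** — the OURS premise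
  ⟨`Rescue.FiniteSupportStaysInBox_ours 2`⟩ on the WHOLE slice `n = 1`. Nothing is claimed for `n ≥ 2`, odd `p`, or infinite support.
Hypotheses: each theorem's own binders; no FACT-LIST fact, no DEFECT binder. Standard axioms only.
-/

noncomputable section

set_option linter.dupNamespace false -- mandated namespace of this single-conjunct summit

namespace Summit.ResolutionOfSingularities.ResolutionOfSingularities.Theorems

namespace CampaignW24

namespace ReducedBridge

open Literature.AlgebraicGeometry.Hironaka2017.S08UnitMonomial (StandardExpression)
open Literature.AlgebraicGeometry.Hironaka2017.S09LLUED
open Literature.AlgebraicGeometry.Hironaka2017.S09LLUED.TopFrontier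
open Literature.AlgebraicGeometry.Hironaka2017.S09LLUED.TopDeriv
open Literature.AlgebraicGeometry.Hironaka2017.S09LLUED.FrontierDrop (expo)
open Literature.AlgebraicGeometry.Resolution (adicOrder)
open Literature.RingTheory.MvPowerSeries (adicOrder_eq_order)
open CampaignW21 (xs hasseD)
open Rescue.RD2Prime (isLowerClass_stepAt_of_isLowerClass)

variable {K : Type} [Field K]

/-! ## §1 Residues of summands; passengers are of lower class -/

/-- The residue of a monomial is read off the summand carrying it. [folklore] -/
theorem residue_of_eq {e ℓ : ℕ} {F : MvPowerSeries (Fin 1) K} (X : StandardExpression 2 (xs K 1) e ℓ F) (he : 0 < e)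
    {s : ExpTriple 1} (hs : s ∈ X.support) {d r : Fin 1 →₀ ℕ} (hd : d = s.1 + 2 • s.2.1 + 2 ^ e • r) :
    d 0 % 2 ^ e = s.1 0 + 2 * s.2.1 0 := by
  subst hd
  simp only [Finsupp.add_apply, Finsupp.smul_apply, smul_eq_mul]
  rw [Nat.add_mul_mod_self_left, Nat.mod_eq_of_lt (digits_lt X he hs)]

omit [Field K] in
/-- On `Fin 1`: `toLex (x·e₀) ≤ toLex (y·e₀) ↔ x ≤ y`. [folklore] -/
theorem toLex_single_le_iff {x y : ℕ} :
    toLex (Finsupp.single (0 : Fin 1) x) ≤ toLex (Finsupp.single (0 : Fin 1) y) ↔ x ≤ y := by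
  rw [Finsupp.Lex.le_iff_of_unique, show (default : Fin 1) = 0 from Subsingleton.elim _ _]
  show Finsupp.single (0 : Fin 1) x 0 ≤ Finsupp.single (0 : Fin 1) y 0 ↔ x ≤ y
  rw [Finsupp.single_eq_same, Finsupp.single_eq_same]

/-- Digits below `r₀` ⇒ pair key below the digit pair of `r₀`. [folklore] -/
theorem pairKey_lt_of_pairLT {e ℓ : ℕ} {F : MvPowerSeries (Fin 1) K} (X : StandardExpression 2 (xs K 1) e ℓ F) {s : ExpTriple 1}
    (hs : s ∈ X.support) {r₀ : ℕ} (h : PairLT (s.1 0 + 2 * s.2.1 0) r₀) :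
    pairKey s < toLex (toLex (Finsupp.single (0 : Fin 1) (r₀ % 2)), toLex (Finsupp.single (0 : Fin 1) (r₀ / 2))) := by
  have hta : s.1 0 < 2 := X.a_lt _ hs 0
  have h' : s.1 0 < r₀ % 2 ∨ (s.1 0 = r₀ % 2 ∧ s.2.1 0 < r₀ / 2) := by
    rcases h with h | ⟨h1, h2⟩
    · left; omega
    · right; constructor <;> omega
  rw [pairKey, eq_single s.1, eq_single s.2.1]
  rcases h' with h | ⟨h1, h2⟩
  · exact Prod.Lex.toLex_lt_toLex.mpr (Or.inl (toLex_single_lt_iff.mpr h))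
  · rw [h1]; exact Prod.Lex.toLex_lt_toLex.mpr (Or.inr ⟨rfl, toLex_single_lt_iff.mpr h2⟩)

/-- Pair key at most the digit pair of `r₀` ⇒ the residue is `r₀` or below it. [folklore] -/
theorem eq_or_pairLT_of_pairKey_le {e ℓ : ℕ} {F : MvPowerSeries (Fin 1) K} (X : StandardExpression 2 (xs K 1) e ℓ F) {s : ExpTriple 1}
    (hs : s ∈ X.support) {r₀ : ℕ}
    (h : pairKey s ≤ toLex (toLex (Finsupp.single (0 : Fin 1) (r₀ % 2)), toLex (Finsupp.single (0 : Fin 1) (r₀ / 2)))) :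
    s.1 0 + 2 * s.2.1 0 = r₀ ∨ PairLT (s.1 0 + 2 * s.2.1 0) r₀ := by
  have hta : s.1 0 < 2 := X.a_lt _ hs 0
  rw [pairKey, eq_single s.1, eq_single s.2.1] at h
  rcases Prod.Lex.toLex_le_toLex.mp h with hlt | ⟨heq, hle⟩
  · have := toLex_single_lt_iff.mp hlt
    right; left; omega
  · have h1 : s.1 0 = r₀ % 2 := Finsupp.single_injective _ (toLex_inj.mp heq)
    have h2 : s.2.1 0 ≤ r₀ / 2 := toLex_single_le_iff.mp hle
    rcases Nat.lt_or_ge (s.2.1 0) (r₀ / 2) with hlt | hge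
    · right; right; constructor <;> omega
    · left; omega

variable [CharP K 2]

/-- **Passengers are of LOWER CLASS** relative to every reference datum `X₀` (depth `ℓ₀ ≥ e > 0`) of `F₀ = Φ_{q,r₀} G₀ + R₀` (`G₀ ≠ 0`), provided
every `good` residue is visible in `F₀`: such a residue is carried by an effective summand of `X₀` with digits below those of `r₀`. [folklore] -/
theorem isLowerClass_of_resIn {e ℓ₀ : ℕ} {F₀ R₀ : MvPowerSeries (Fin 1) K} {G₀ : PowerSeries K} {r₀ : ℕ} {good : ℕ → Prop}
    (X₀ : StandardExpression 2 (xs K 1) e ℓ₀ F₀) (hF₀ : F₀ = phiQ (2 ^ e) (two_pow_ne_zero' e) r₀ G₀ + R₀) (hr₀ : r₀ < 2 ^ e)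
    (hR₀ : ResIn (2 ^ e) good R₀) (hgood : ∀ ρ, good ρ → PairLT ρ r₀) (he : 0 < e) (hle₀ : e ≤ ℓ₀) (hG₀ : G₀ ≠ 0)
    (hvis : ∀ ρ, good ρ → ∃ d : Fin 1 →₀ ℕ, MvPowerSeries.coeff d F₀ ≠ 0 ∧ d 0 % 2 ^ e = ρ)
    {R : MvPowerSeries (Fin 1) K} (hR : ResIn (2 ^ e) good R) : IsLowerClass X₀ R := by
  haveI : Fact (Nat.Prime 2) := ⟨Nat.prime_two⟩
  obtain ⟨hα, hβ⟩ := alpha_beta_of_level X₀ hF₀ hr₀ hR₀ hgood he hle₀ hG₀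
  intro m hm
  obtain ⟨d, hd, hdρ⟩ := hvis _ (hR m hm)
  obtain ⟨s, hs, r, hr⟩ := exists_mem_effSupport_of_coeff_ne_zero hle₀ X₀ hd
  obtain ⟨hss, hus⟩ := mem_effSupport.mp hs
  have hres : d 0 % 2 ^ e = s.1 0 + 2 * s.2.1 0 := residue_of_eq X₀ he hss hr
  refine ⟨s, hss, hus, ?_, fun i => ?_⟩
  · rw [hα, hβ]
    refine pairKey_lt_of_pairLT X₀ hss ?_
    rw [← hres, hdρ]
    exact hgood _ (hR m hm)
  · have hi : i = 0 := Subsingleton.elim _ _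
    subst hi
    show m 0 % 2 ^ e = expo 2 e s 0 % 2 ^ e
    rw [expo_mod X₀ he hss, ← hres, hdρ]

/-! ## §2 Runs at level `e` and box-confinement from in-box reduced exhaustion -/

/-- **Run bridge at level `e` (bottom digit `≥ 2` at the start), up to the reduced death index**: the top residue class runs as res-L1-k24's
canonical reduced run at depth `2^{ℓ−e}`, the passenger keeps its residues in `good`. [folklore] -/
theorem run_of_level {e ℓ : ℕ} (he : 0 < e) (hle : e ≤ ℓ) {r₀ : ℕ} (hr₀ : r₀ < 2 ^ e) {good : ℕ → Prop}
    (hgood : ∀ ρ, good ρ → PairLT ρ r₀) {G₀ : PowerSeries K} {R₀ : MvPowerSeries (Fin 1) K} (hR₀ : ResIn (2 ^ e) good R₀)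
    {N : ℕ} {εs : ℕ → MvPowerSeries (Fin 1) K} (h0 : εs 0 = phiQ (2 ^ e) (two_pow_ne_zero' e) r₀ G₀ + R₀)
    (hrun : IsBottomRun 2 e ℓ εs N) {i₁ : ℕ}
    (hpre : ∀ i < i₁, ReducedRun.canonRun (2 ^ (ℓ - e)) G₀ i ≠ 0 ∧
      (2 : ℕ∞) ≤ PowerSeries.order (ReducedRun.canonRun (2 ^ (ℓ - e)) G₀ i)) :
    ∀ i ≤ N, i ≤ i₁ → ∃ Ri : MvPowerSeries (Fin 1) K, ResIn (2 ^ e) good Ri ∧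
      εs i = phiQ (2 ^ e) (two_pow_ne_zero' e) r₀ (ReducedRun.canonRun (2 ^ (ℓ - e)) G₀ i) + Ri := by
  intro i
  induction i with
  | zero => exact fun _ _ => ⟨R₀, hR₀, h0⟩
  | succ i ih =>
    intro hi hi₁
    obtain ⟨Ri, hRi, hεi⟩ := ih (Nat.le_of_succ_le hi) (Nat.le_of_succ_le hi₁)
    obtain ⟨X, w, c, hX0, hsole, -, hw, hstep⟩ := hrun i hi
    obtain ⟨hne, h2⟩ := hpre i hi₁
    have hfin : PowerSeries.order (ReducedRun.canonRun (2 ^ (ℓ - e)) G₀ i) =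
        ((PowerSeries.order (ReducedRun.canonRun (2 ^ (ℓ - e)) G₀ i)).toNat : ℕ∞) :=
      (ENat.coe_toNat fun h => hne (PowerSeries.order_eq_top.mp h)).symm
    have h2k : 2 ≤ (PowerSeries.order (ReducedRun.canonRun (2 ^ (ℓ - e)) G₀ i)).toNat := by
      rw [hfin] at h2
      exact_mod_cast h2
    obtain ⟨R', hR', hE'⟩ := stepAt_of_level_caseI X hεi hr₀ hRi hgood he hle hX0 hfin h2k hsole hw c
    exact ⟨R', hR', by rw [hstep, hE']; rfl⟩

/-- **Lower class persists along a legal run at level `e`** (res-D-pv-031's one-step persistence, iterated). [folklore] -/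
theorem isLowerClass_run_of_level {e ℓ ℓ₀ : ℕ} (he : 0 < e) (hle : e ≤ ℓ) {F₀ : MvPowerSeries (Fin 1) K}
    (X₀ : StandardExpression 2 (xs K 1) e ℓ₀ F₀) {N : ℕ} {εs : ℕ → MvPowerSeries (Fin 1) K} (hrun : IsBottomRun 2 e ℓ εs N)
    {j₀ : ℕ} (hj₀ : IsLowerClass X₀ (εs j₀)) : ∀ j, j₀ ≤ j → j ≤ N → IsLowerClass X₀ (εs j) := by
  haveI : Fact (Nat.Prime 2) := ⟨Nat.prime_two⟩
  intro j hj hjN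
  obtain ⟨d, rfl⟩ := Nat.exists_eq_add_of_le hj
  induction d with
  | zero => exact hj₀
  | succ d ih =>
    obtain ⟨X, w, c, hX0, -, -, hw, hstep⟩ := hrun (j₀ + d) (by omega)
    rw [← add_assoc, hstep]
    exact isLowerClass_stepAt_of_isLowerClass X₀ he (ih (by omega) (by omega)) X hle hX0 hw c

/-- **Box-confinement at level `e` from in-box reduced exhaustion of the top residue class** (bottom digit `≥ 2` at the start): in-box states
`i < i₁` have bottom digit `< 2^{ℓ−e}`; the state `i₁` is the passenger alone, of lower class, and lower class persists. [folklore] -/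
theorem staysInBox_of_level_of_reduced_exhaustion {e ℓ₀ ℓ : ℕ} (he : 0 < e) (hle : e ≤ ℓ) {r₀ : ℕ} (hr₀ : r₀ < 2 ^ e)
    {good : ℕ → Prop} (hgood : ∀ ρ, good ρ → PairLT ρ r₀) {G₀ : PowerSeries K} (hG₀ : G₀ ≠ 0) {F₀ R₀ : MvPowerSeries (Fin 1) K}
    (X₀ : StandardExpression 2 (xs K 1) e ℓ₀ F₀) (hF₀ : F₀ = phiQ (2 ^ e) (two_pow_ne_zero' e) r₀ G₀ + R₀)
    (hR₀ : ResIn (2 ^ e) good R₀) (hle₀ : e ≤ ℓ₀)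
    (hvis : ∀ ρ, good ρ → ∃ d : Fin 1 →₀ ℕ, MvPowerSeries.coeff d F₀ ≠ 0 ∧ d 0 % 2 ^ e = ρ) {i₁ : ℕ}
    (hpre : ∀ i < i₁, ReducedRun.canonRun (2 ^ (ℓ - e)) G₀ i ≠ 0 ∧
      (2 : ℕ∞) ≤ PowerSeries.order (ReducedRun.canonRun (2 ^ (ℓ - e)) G₀ i) ∧
      PowerSeries.order (ReducedRun.canonRun (2 ^ (ℓ - e)) G₀ i) < ((2 ^ (ℓ - e) : ℕ) : ℕ∞))
    (hzero : ReducedRun.canonRun (2 ^ (ℓ - e)) G₀ i₁ = 0) :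
    StaysInBox 2 e ℓ X₀ := by
  intro N εs h0 hrun hnl X hX0
  have h0' : εs 0 = phiQ (2 ^ e) (two_pow_ne_zero' e) r₀ G₀ + R₀ := by rw [h0, hF₀]
  rcases Nat.lt_or_ge N i₁ with hlt | hge
  · obtain ⟨RN, hRN, hεN⟩ :=
      run_of_level he hle hr₀ hgood hR₀ h0' hrun (fun i hi => ⟨(hpre i hi).1, (hpre i hi).2.1⟩) N le_rfl hlt.le
    obtain ⟨hne, -, hP⟩ := hpre N hlt
    set GN := ReducedRun.canonRun (2 ^ (ℓ - e)) G₀ N with hGN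
    have hfin : PowerSeries.order GN = ((PowerSeries.order GN).toNat : ℕ∞) :=
      (ENat.coe_toNat fun h => hne (PowerSeries.order_eq_top.mp h)).symm
    rw [hfin] at hP
    exact (depthBox_iff_of_level X hεN hr₀ hRN hgood he hle hX0 hfin).mpr (by exact_mod_cast hP)
  · exfalso
    obtain ⟨Ri, hRi, hεi⟩ :=
      run_of_level he hle hr₀ hgood hR₀ h0' hrun (fun i hi => ⟨(hpre i hi).1, (hpre i hi).2.1⟩) i₁ hge le_rfl
    rw [hzero, phiQ_zero, zero_add] at hεi
    have hlow : IsLowerClass X₀ (εs i₁) := by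
      rw [hεi]; exact isLowerClass_of_resIn X₀ hF₀ hr₀ hR₀ hgood he hle₀ hG₀ hvis hRi
    exact hnl (isLowerClass_run_of_level he hle X₀ hrun hlow N hge le_rfl)

/-- **Run bridge at level `e`, bottom digit `1`**: after the forced Case-(III) first step the top class is `canonRun 2^{ℓ−e} G₁ (i−1)`,
`G₁ = canonStepIIIq 2^{ℓ−e} k̄ G₀`, `k̄ = q / r₀ + 1`, up to the reduced death index of `G₁`. [folklore] -/
theorem run_of_level_digitOne {e ℓ : ℕ} (he : 0 < e) (hle : e ≤ ℓ) {r₀ : ℕ} (hr₀ : r₀ < 2 ^ e) (hr₀pos : 0 < r₀)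
    {good : ℕ → Prop} (hgood : ∀ ρ, good ρ → PairLT ρ r₀) {G₀ : PowerSeries K} (hk : PowerSeries.order G₀ = (1 : ℕ))
    {R₀ : MvPowerSeries (Fin 1) K} (hR₀ : ResIn (2 ^ e) good R₀) {N : ℕ} {εs : ℕ → MvPowerSeries (Fin 1) K}
    (h0 : εs 0 = phiQ (2 ^ e) (two_pow_ne_zero' e) r₀ G₀ + R₀) (hrun : IsBottomRun 2 e ℓ εs N) {i₁ : ℕ}
    (hpre : ∀ i < i₁, ReducedRun.canonRun (2 ^ (ℓ - e)) (ReducedRun.canonStepIIIq (2 ^ (ℓ - e)) (2 ^ e / r₀ + 1) G₀) i ≠ 0 ∧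
      (2 : ℕ∞) ≤ PowerSeries.order
        (ReducedRun.canonRun (2 ^ (ℓ - e)) (ReducedRun.canonStepIIIq (2 ^ (ℓ - e)) (2 ^ e / r₀ + 1) G₀) i)) :
    ∀ i, i + 1 ≤ N → i ≤ i₁ → ∃ Ri : MvPowerSeries (Fin 1) K, ResIn (2 ^ e) good Ri ∧
      εs (i + 1) = phiQ (2 ^ e) (two_pow_ne_zero' e) r₀
        (ReducedRun.canonRun (2 ^ (ℓ - e)) (ReducedRun.canonStepIIIq (2 ^ (ℓ - e)) (2 ^ e / r₀ + 1) G₀) i) + Ri := by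
  intro i hi hi₁
  obtain ⟨X, w, c, hX0, hsole, -, hw, hstep⟩ := hrun 0 (by omega)
  obtain ⟨R₁, hR₁, hE₁⟩ := stepAt_of_level_caseIII X h0 hr₀ hr₀pos hR₀ hgood he hle hX0 hk hsole hw c
  have h1 : εs 1 = phiQ (2 ^ e) (two_pow_ne_zero' e) r₀ (ReducedRun.canonStepIIIq (2 ^ (ℓ - e)) (2 ^ e / r₀ + 1) G₀) + R₁ := by
    rw [hstep, hE₁]
  have hrun' : IsBottomRun 2 e ℓ (fun j => εs (j + 1)) i := fun j hj => hrun (j + 1) (by omega)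
  exact run_of_level he hle hr₀ hgood hR₁ h1 hrun' hpre i le_rfl hi₁

/-- **Box-confinement at level `e`, bottom digit `1`** (`ℓ ≥ e + 1`, `ord G₀ = 1`) from in-box reduced exhaustion of the second state.
[folklore] -/
theorem staysInBox_of_level_of_reduced_exhaustion_digitOne {e ℓ₀ ℓ : ℕ} (he : 0 < e) (hle : e + 1 ≤ ℓ) {r₀ : ℕ} (hr₀ : r₀ < 2 ^ e)
    (hr₀pos : 0 < r₀) {good : ℕ → Prop} (hgood : ∀ ρ, good ρ → PairLT ρ r₀) {G₀ : PowerSeries K}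
    (hk : PowerSeries.order G₀ = (1 : ℕ)) {F₀ R₀ : MvPowerSeries (Fin 1) K} (X₀ : StandardExpression 2 (xs K 1) e ℓ₀ F₀)
    (hF₀ : F₀ = phiQ (2 ^ e) (two_pow_ne_zero' e) r₀ G₀ + R₀) (hR₀ : ResIn (2 ^ e) good R₀) (hle₀ : e ≤ ℓ₀)
    (hvis : ∀ ρ, good ρ → ∃ d : Fin 1 →₀ ℕ, MvPowerSeries.coeff d F₀ ≠ 0 ∧ d 0 % 2 ^ e = ρ) {i₁ : ℕ}
    (hpre : ∀ i < i₁, ReducedRun.canonRun (2 ^ (ℓ - e)) (ReducedRun.canonStepIIIq (2 ^ (ℓ - e)) (2 ^ e / r₀ + 1) G₀) i ≠ 0 ∧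
      (2 : ℕ∞) ≤ PowerSeries.order
        (ReducedRun.canonRun (2 ^ (ℓ - e)) (ReducedRun.canonStepIIIq (2 ^ (ℓ - e)) (2 ^ e / r₀ + 1) G₀) i) ∧
      PowerSeries.order (ReducedRun.canonRun (2 ^ (ℓ - e)) (ReducedRun.canonStepIIIq (2 ^ (ℓ - e)) (2 ^ e / r₀ + 1) G₀) i) <
        ((2 ^ (ℓ - e) : ℕ) : ℕ∞))
    (hzero : ReducedRun.canonRun (2 ^ (ℓ - e)) (ReducedRun.canonStepIIIq (2 ^ (ℓ - e)) (2 ^ e / r₀ + 1) G₀) i₁ = 0) :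
    StaysInBox 2 e ℓ X₀ := by
  have hle1 : e ≤ ℓ := by omega
  have hG₀ : G₀ ≠ 0 := fun h => by rw [h, PowerSeries.order_zero] at hk; exact ENat.top_ne_coe _ hk
  intro N εs h0 hrun hnl X hX0
  have h0' : εs 0 = phiQ (2 ^ e) (two_pow_ne_zero' e) r₀ G₀ + R₀ := by rw [h0, hF₀]
  rcases N with _ | M
  · exact (depthBox_iff_of_level X h0' hr₀ hR₀ hgood he hle1 hX0 hk).mpr (Nat.one_lt_two_pow (by omega))
  · rcases Nat.lt_or_ge M i₁ with hlt | hge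
    · obtain ⟨RM, hRM, hεM⟩ := run_of_level_digitOne he hle1 hr₀ hr₀pos hgood hk hR₀ h0' hrun
        (fun i hi => ⟨(hpre i hi).1, (hpre i hi).2.1⟩) M le_rfl hlt.le
      obtain ⟨hne, -, hP⟩ := hpre M hlt
      set GM := ReducedRun.canonRun (2 ^ (ℓ - e)) (ReducedRun.canonStepIIIq (2 ^ (ℓ - e)) (2 ^ e / r₀ + 1) G₀) M with hGM
      have hfin : PowerSeries.order GM = ((PowerSeries.order GM).toNat : ℕ∞) :=
        (ENat.coe_toNat fun h => hne (PowerSeries.order_eq_top.mp h)).symm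
      rw [hfin] at hP
      exact (depthBox_iff_of_level X hεM hr₀ hRM hgood he hle1 hX0 hfin).mpr (by exact_mod_cast hP)
    · exfalso
      obtain ⟨Ri, hRi, hεi⟩ := run_of_level_digitOne he hle1 hr₀ hr₀pos hgood hk hR₀ h0' hrun
        (fun i hi => ⟨(hpre i hi).1, (hpre i hi).2.1⟩) i₁ (by omega) le_rfl
      rw [hzero, phiQ_zero, zero_add] at hεi
      have hlow : IsLowerClass X₀ (εs (i₁ + 1)) := by
        rw [hεi]; exact isLowerClass_of_resIn X₀ hF₀ hr₀ hR₀ hgood he hle₀ hG₀ hvis hRi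
      exact hnl (isLowerClass_run_of_level he hle1 X₀ hrun hlow (M + 1) (by omega) le_rfl)

/-! ## §3 `StaysInBox` at every large depth (res-L1-type-o6's reduced death theorem on the top residue class) -/

/-- **`StaysInBox 2 e ℓ X₀` at every large depth, bottom digit `≥ 2`** (`G₀ ≠ 0` finitely supported, `2 ≤ ord G₀`). [folklore] -/
theorem staysInBox_of_level_eventually_of_two_le_order {e ℓ₀ : ℕ} (he : 0 < e) {r₀ : ℕ} (hr₀ : r₀ < 2 ^ e) {good : ℕ → Prop}
    (hgood : ∀ ρ, good ρ → PairLT ρ r₀) {G₀ : PowerSeries K} (hG₀ : G₀ ≠ 0) (hfin : ∃ B : ℕ, ∀ m, B < m → PowerSeries.coeff m G₀ = 0)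
    (h2 : (2 : ℕ∞) ≤ PowerSeries.order G₀) {F₀ R₀ : MvPowerSeries (Fin 1) K} (X₀ : StandardExpression 2 (xs K 1) e ℓ₀ F₀)
    (hF₀ : F₀ = phiQ (2 ^ e) (two_pow_ne_zero' e) r₀ G₀ + R₀) (hR₀ : ResIn (2 ^ e) good R₀) (hle₀ : e ≤ ℓ₀)
    (hvis : ∀ ρ, good ρ → ∃ d : Fin 1 →₀ ℕ, MvPowerSeries.coeff d F₀ ≠ 0 ∧ d 0 % 2 ^ e = ρ) :
    ∃ ℓ₁ : ℕ, ∀ ℓ, ℓ₁ ≤ ℓ → StaysInBox 2 e ℓ X₀ := by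
  obtain ⟨i₁, Bstar, h⟩ := ReducedRun.reduced_exhaustion_of_two_le_order G₀ hfin h2
  refine ⟨e + Bstar + 1, fun ℓ hℓ => ?_⟩
  have hP : Bstar < 2 ^ (ℓ - e) := lt_of_lt_of_le Nat.lt_two_pow_self (Nat.pow_le_pow_right two_pos (by omega))
  obtain ⟨hpre, hzero⟩ := h (2 ^ (ℓ - e)) hP
  exact staysInBox_of_level_of_reduced_exhaustion he (by omega) hr₀ hgood hG₀ X₀ hF₀ hR₀ hle₀ hvis
    (fun i hi => ⟨(hpre i hi).1, (hpre i hi).2.1, by exact_mod_cast (hpre i hi).2.2⟩) hzero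

/-- **`StaysInBox 2 e ℓ X₀` at every large depth, bottom digit `1`** (`G₀` finitely supported, `ord G₀ = 1`, `0 < r₀`): the second state
`univStepIIIq k̄ G₀` is finitely supported of order `≥ 2`, so o6's death theorem applies to it. [folklore] -/
theorem staysInBox_of_level_eventually_of_order_eq_one {e ℓ₀ : ℕ} (he : 0 < e) {r₀ : ℕ} (hr₀ : r₀ < 2 ^ e) (hr₀pos : 0 < r₀)
    {good : ℕ → Prop} (hgood : ∀ ρ, good ρ → PairLT ρ r₀) {G₀ : PowerSeries K}
    (hfin : ∃ B : ℕ, ∀ m, B < m → PowerSeries.coeff m G₀ = 0) (hk : PowerSeries.order G₀ = (1 : ℕ))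
    {F₀ R₀ : MvPowerSeries (Fin 1) K} (X₀ : StandardExpression 2 (xs K 1) e ℓ₀ F₀)
    (hF₀ : F₀ = phiQ (2 ^ e) (two_pow_ne_zero' e) r₀ G₀ + R₀) (hR₀ : ResIn (2 ^ e) good R₀) (hle₀ : e ≤ ℓ₀)
    (hvis : ∀ ρ, good ρ → ∃ d : Fin 1 →₀ ℕ, MvPowerSeries.coeff d F₀ ≠ 0 ∧ d 0 % 2 ^ e = ρ) :
    ∃ ℓ₁ : ℕ, ∀ ℓ, ℓ₁ ≤ ℓ → StaysInBox 2 e ℓ X₀ := by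
  obtain ⟨B, hB⟩ := hfin
  have h00 : PowerSeries.constantCoeff G₀ = 0 := by
    rw [← PowerSeries.coeff_zero_eq_constantCoeff_apply]
    exact (PowerSeries.order_eq_nat.mp hk).2 0 Nat.one_pos
  set kb := 2 ^ e / r₀ + 1 with hkb
  set G₁ := ReducedRun.univStepIIIq kb G₀ with hG₁
  obtain ⟨i₁, Bstar, h⟩ := ReducedRun.reduced_exhaustion_of_two_le_order G₁
    ⟨(2 ^ kb + 1) * B, ReducedRun.coeff_univStepIIIq_eq_zero_of_bound hB⟩ (ReducedRun.two_le_order_univStepIIIq kb h00)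
  refine ⟨e + max Bstar B + 1, fun ℓ hℓ => ?_⟩
  have hpow : max Bstar B < 2 ^ (ℓ - e) :=
    lt_of_lt_of_le Nat.lt_two_pow_self (Nat.pow_le_pow_right two_pos (by omega))
  have hP : Bstar < 2 ^ (ℓ - e) := lt_of_le_of_lt (le_max_left _ _) hpow
  have hcanon : ReducedRun.canonStepIIIq (2 ^ (ℓ - e)) kb G₀ = G₁ :=
    ReducedRun.canonStepIIIq_eq_univStepIIIq fun m hm => hB m (by have := le_max_right Bstar B; omega)
  obtain ⟨hpre, hzero⟩ := h (2 ^ (ℓ - e)) hP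
  refine staysInBox_of_level_of_reduced_exhaustion_digitOne he (by omega) hr₀ hr₀pos hgood hk X₀ hF₀ hR₀ hle₀ hvis (i₁ := i₁) ?_ ?_
  · intro i hi
    rw [hcanon]
    exact ⟨(hpre i hi).1, (hpre i hi).2.1, by exact_mod_cast (hpre i hi).2.2⟩
  · rw [hcanon]; exact hzero

/-! ## §4 THE WHOLE SLICE `n = 1` of ⟨`Rescue.FiniteSupportStaysInBox_ours`⟩ at `p = 2` -/

/-- **THE SLICE THEOREM AT EVERY LEVEL.** For every field `K` of characteristic `2` (`[ExpChar K 2] [PerfectRing K 2]`, the binders of the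
OURS premise), EVERY level `e` and EVERY polynomial `P ∈ K[x]`: `Rescue.CarrierStaysInBox 2 e ↑P` — ⟨`Rescue.FiniteSupportStaysInBox_ours 2`⟩
HOLDS ON THE WHOLE SLICE `n = 1`, no carrier-shape proviso. Given a reference datum `X₀` (top pair `(α, β)`, `α ≠ 0`, `q = 2^e < ord P`):
`r₀ := α + 2β` (top residue, odd, `< q`), `G :=` the residue-`r₀` class of `P` read in `x^q` (`G ≠ 0`, `G(0) = 0`, finitely supported),
`R := P − x^{r₀}G(x^q)` (a passenger: residues visible in `P`, digit pairs below `(α, β)`); the top class runs as res-L1-k24's reduced run (death by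
res-L1-type-o6's potential; bottom digit `1` via the Case-(III) step, `k̄ = q / r₀ + 1`), the passenger never feeds back and is of lower class once
the top class is exhausted. Nothing for `n ≥ 2`, odd `p`, or infinite support. OURS objects; nothing about the manuscript. [folklore] -/
theorem carrierStaysInBox_coe_fin_one_level [ExpChar K 2] [PerfectRing K 2] (e : ℕ) (P : MvPolynomial (Fin 1) K) :
    Rescue.CarrierStaysInBox 2 e (P : MvPowerSeries (Fin 1) K) := by
  intro ℓ₀ X₀ he hle h0 hα hord
  have htop := mem_topBlock.mp (bot_mem X₀ h0)
  have hts : (alpha X₀.support X₀.u, beta X₀.support X₀.u, gammaStar X₀.support X₀.u) ∈ X₀.support := (mem_effSupport.mp htop.1).1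
  set r₀ : ℕ := alpha X₀.support X₀.u 0 + 2 * beta X₀.support X₀.u 0 with hr₀def
  have hr₀ : r₀ < 2 ^ e := digits_lt X₀ he hts
  have hα1 : alpha X₀.support X₀.u 0 = 1 := by
    have h2 : alpha X₀.support X₀.u 0 < 2 := X₀.a_lt _ hts 0
    have hne : alpha X₀.support X₀.u 0 ≠ 0 := fun h =>
      hα (by rw [eq_single (alpha X₀.support X₀.u), h, Finsupp.single_zero])
    omega
  have hr₀pos : 0 < r₀ := by omega
  have hαe : alpha X₀.support X₀.u = Finsupp.single 0 (r₀ % 2) := by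
    rw [eq_single (alpha X₀.support X₀.u), hα1]; congr 1; omega
  have hβe : beta X₀.support X₀.u = Finsupp.single 0 (r₀ / 2) := by
    rw [eq_single (beta X₀.support X₀.u)]; congr 1; omega
  set G : PowerSeries K := PowerSeries.mk fun m => MvPowerSeries.coeff (Finsupp.single 0 (r₀ + 2 ^ e * m)) (P : MvPowerSeries (Fin 1) K) with hG
  set R : MvPowerSeries (Fin 1) K := (P : MvPowerSeries (Fin 1) K) - phiQ (2 ^ e) (two_pow_ne_zero' e) r₀ G with hR
  have hF : (P : MvPowerSeries (Fin 1) K) = phiQ (2 ^ e) (two_pow_ne_zero' e) r₀ G + R := by rw [hR, add_sub_cancel]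
  have hres : ∀ d : Fin 1 →₀ ℕ, MvPowerSeries.coeff d (P : MvPowerSeries (Fin 1) K) ≠ 0 → d 0 % 2 ^ e = r₀ ∨ PairLT (d 0 % 2 ^ e) r₀ := by
    intro d hd
    obtain ⟨s, hs, r, hr⟩ := exists_mem_effSupport_of_coeff_ne_zero hle X₀ hd
    have hss := (mem_effSupport.mp hs).1
    rw [residue_of_eq X₀ he hss hr]
    have hk := pairKey_le_top hs
    rw [hαe, hβe] at hk
    exact eq_or_pairLT_of_pairKey_le X₀ hss hk
  have hRin : ResIn (2 ^ e)
      (fun ρ => PairLT ρ r₀ ∧ ∃ d : Fin 1 →₀ ℕ, MvPowerSeries.coeff d (P : MvPowerSeries (Fin 1) K) ≠ 0 ∧ d 0 % 2 ^ e = ρ) R := by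
    intro d hd
    by_cases hdr : d 0 % 2 ^ e = r₀
    · exfalso
      apply hd
      rw [hR, map_sub, coeff_phiQ_of_lt _ hr₀, if_pos hdr, hG, PowerSeries.coeff_mk]
      have hd' : Finsupp.single (0 : Fin 1) (r₀ + 2 ^ e * (d 0 / 2 ^ e)) = d := by
        conv_rhs => rw [eq_single d]
        congr 1
        rw [← hdr]
        exact Nat.mod_add_div _ _
      rw [hd', sub_self]
    · have hdF : MvPowerSeries.coeff d (P : MvPowerSeries (Fin 1) K) ≠ 0 := by
        rwa [hR, map_sub, coeff_phiQ_of_lt _ hr₀, if_neg hdr, sub_zero] at hd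
      exact ⟨(hres d hdF).resolve_left hdr, d, hdF, rfl⟩
  have hgood : ∀ ρ, (PairLT ρ r₀ ∧ ∃ d : Fin 1 →₀ ℕ, MvPowerSeries.coeff d (P : MvPowerSeries (Fin 1) K) ≠ 0 ∧ d 0 % 2 ^ e = ρ) →
      PairLT ρ r₀ := fun ρ h => h.1
  have hvis : ∀ ρ, (PairLT ρ r₀ ∧ ∃ d : Fin 1 →₀ ℕ, MvPowerSeries.coeff d (P : MvPowerSeries (Fin 1) K) ≠ 0 ∧ d 0 % 2 ^ e = ρ) →
      ∃ d : Fin 1 →₀ ℕ, MvPowerSeries.coeff d (P : MvPowerSeries (Fin 1) K) ≠ 0 ∧ d 0 % 2 ^ e = ρ := fun ρ h => h.2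
  have hGne : G ≠ 0 := by
    obtain ⟨m, hm, hmod⟩ := TopDeriv.exists_coeff_ne_zero_of_mem_effSupport he hle X₀ htop.1
    have hmr : m 0 % 2 ^ e = r₀ := Eq.trans (hmod 0) (expo_mod X₀ he hts)
    intro hG0
    apply hm
    rw [hF, map_add, coeff_phiQ_of_lt _ hr₀, if_pos hmr, hG0, map_zero, zero_add]
    exact hRin.coeff_eq_zero fun h => (hgood _ h).ne hmr
  have hG00 : PowerSeries.constantCoeff G = 0 := by
    by_contra hc
    rw [adicOrder_eq_order] at hord
    have hcoeff : MvPowerSeries.coeff (Finsupp.single 0 (r₀ + 2 ^ e * 0)) (P : MvPowerSeries (Fin 1) K) ≠ 0 := by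
      rwa [coeff_top_residue hF hr₀ hRin hgood, PowerSeries.coeff_zero_eq_constantCoeff_apply]
    have hle' := MvPowerSeries.order_le hcoeff
    rw [Finsupp.degree_single, mul_zero, add_zero] at hle'
    have h1 : ((2 ^ e : ℕ) : ℕ∞) < (r₀ : ℕ∞) := lt_of_lt_of_le hord hle'
    exact absurd (by exact_mod_cast h1 : 2 ^ e < r₀) (by omega)
  have hGfin : ∃ B : ℕ, ∀ m, B < m → PowerSeries.coeff m G = 0 := by
    refine ⟨P.totalDegree, fun m hm => ?_⟩
    rw [hG, PowerSeries.coeff_mk]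
    refine coeff_coe_eq_zero_of_totalDegree_lt P _ ?_
    rw [Finsupp.single_eq_same]
    have h1 : m ≤ 2 ^ e * m := Nat.le_mul_of_pos_left m (pow_pos two_pos e)
    omega
  by_cases hc1 : PowerSeries.coeff 1 G = 0
  · have h2 : (2 : ℕ∞) ≤ PowerSeries.order G := PowerSeries.nat_le_order _ _ fun i hi => by
      interval_cases i
      · rw [PowerSeries.coeff_zero_eq_constantCoeff]; exact hG00
      · exact hc1
    obtain ⟨ℓ₁, hℓ₁⟩ := staysInBox_of_level_eventually_of_two_le_order he hr₀ hgood hGne hGfin h2 X₀ hF hRin hle hvis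
    exact ⟨max ℓ₀ ℓ₁, le_max_left _ _, hℓ₁ _ (le_max_right _ _)⟩
  · have hk : PowerSeries.order G = (1 : ℕ) := PowerSeries.order_eq_nat.mpr ⟨hc1, fun i hi => by
      interval_cases i
      rw [PowerSeries.coeff_zero_eq_constantCoeff]; exact hG00⟩
    obtain ⟨ℓ₁, hℓ₁⟩ := staysInBox_of_level_eventually_of_order_eq_one he hr₀ hr₀pos hgood hGfin hk X₀ hF hRin hle hvis
    exact ⟨max ℓ₀ ℓ₁, le_max_left _ _, hℓ₁ _ (le_max_right _ _)⟩

end ReducedBridge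

end CampaignW24

end Summit.ResolutionOfSingularities.ResolutionOfSingularities.Theorems

end
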